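import Summits.RiemannHypothesis.RiemannHypothesis.Theorems.PfPersistenceRatioRejection
import HarnessLib

/-!
# PF persistence — the SOUND side of the ratio conjunct: an accepted member is at most `τ/(1 − τ)` times its own
low-plane height negative; the `(Z)`-cell's residue and its typed failure mode
(pub-rhpf barrier-prover gen 5, file 4; CASE-DAG leaf G1.21b / §6 PINCER `(Z)`-cell)

**HONEST FRAMING. This is a long-odds MECHANISM / RIGIDITY campaign; no RH claims.** RH-free linear algebra on
window matrices; `ζ`'s Weil positivity is never assumed or concluded; the plane heights are HYPOTHESES.

## What is proved

File 1 (`PfPersistenceRatioRejection` 1e789d75d549) is the REJECTING direction of the law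
"`m`-negative + plane of height `≤ B` + `τB < m(1 − τ)` ⟹ not accepted". Read contrapositively it is a SOUNDNESS
statement, member-agnostic and sign-blind:

* §1 `neg_mul_le_bottomRayleigh_of_gaugeRatio` — matrix level: if `|ε₁| ≤ τ(ε₂ − ε₁)` (`0 ≤ τ < 1`) and some
  plane has Rayleigh height `≤ B`, then `ε₁ ≥ −τB/(1 − τ)`: ACCEPTANCE ⟹ NEAR-POSITIVITY at the scale of the
  member's own low plane. `…_of_modulusRatio`: `|ε₁| ≤ κ|ε₂|`, `0 ≤ κ < 1`, plane `≤ B`, `B ≥ 0` ⟹ `ε₁ ≥ −κB`.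
* §2 `bottomRayleigh_ge_of_mem_gaugeRatioAt` / `…modulusRatioAt` — datum level at a window.
* §3 THE RESIDUE, TYPED. `zeta_bottom_ge_of_mem_gaugeRatioAt`: if `ζ ∈ gaugeRatioAt τ w` and `ζ` has a plane of
  height `≤ η₂` at `w`, then `ε₁(ζ; w) ≥ −τη₂/(1 − τ)`; `zeta_not_mem_gaugeRatioAt_of_deep_negative`: conversely a
  window where `ζ` is MORE than `τη₂/(1 − τ)` negative below a plane of height `η₂` violates the conjunct. So the
  statement the `(Z)`-cell leaves standing — `ζ ∈ ⋂_w gaugeRatioAt τ w` (file 2,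
  `zeta_mem_gaugeRatioClass_of_separates`) — says, given `ζ`'s 2-cluster (B2, DATA PF-N2): "`ζ` is nowhere
  negative by more than `τ/(1 − τ)` times its own cluster height", and its ONLY failure mode is a window where
  `ζ` is deeply negative relative to its cluster. Whether that happens is RH-strength and is not touched here.
* §4 `separates_gaugeRatio_sound_reading` — for the carver: if a class inside the conjunct at `w` contains a member
  `d` with a plane of height `≤ B` at `w`, then `d` is at most `τB/(1 − τ)` negative at `w` (the conjunct never
  accepts a member deeply negative relative to ITS OWN low plane — the exact sense in which the sign-blind scale
  conjunct "sees" negativity).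

References: R. Courant, D. Hilbert, Methods of Mathematical Physics I, §I.4; file 1.
-/

set_option linter.dupNamespace false

noncomputable section

open Real Set Matrix

namespace Summit.RiemannHypothesis.RiemannHypothesis.Theorems.PfPersistence

/-! ## §1 Matrix level: acceptance implies near-positivity at the scale of a low plane -/

/-- **PROVED — ACCEPTANCE ⟹ NEAR-POSITIVITY (gauge ratio).** If `|ε₁(M)| ≤ τ·(ε₂ − ε₁)(M)` with `0 ≤ τ < 1` and
the Rayleigh quotient is `≤ B` on the plane of two nonzero orthogonal vectors, then `−τB/(1 − τ) ≤ ε₁(M)`,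
stated division-free as `−τB ≤ (1 − τ)·ε₁(M)` (in which form it holds for every `τ ≥ 0`). [folklore] -/
theorem neg_mul_le_bottomRayleigh_of_gaugeRatio {n : ℕ} {M : Matrix (Fin (n + 1)) (Fin (n + 1)) ℝ}
    {x y : Fin (n + 1) → ℝ} (hx : x ≠ 0) (hy : y ≠ 0) (hxy : y ⬝ᵥ x = 0) {B : ℝ}
    (hB : ∀ α β : ℝ, (α • x + β • y) ⬝ᵥ (M *ᵥ (α • x + β • y)) ≤ B * ((α • x + β • y) ⬝ᵥ (α • x + β • y)))
    {τ : ℝ} (hτ0 : 0 ≤ τ) (hacc : |bottomRayleigh M| ≤ τ * (secondRayleigh M - bottomRayleigh M)) :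
    -(τ * B) ≤ (1 - τ) * bottomRayleigh M := by
  have h2 : secondRayleigh M ≤ B := secondRayleigh_le_of_plane hx hy hxy hB
  have h3 : τ * secondRayleigh M ≤ τ * B := mul_le_mul_of_nonneg_left h2 hτ0
  by_cases h0 : 0 ≤ bottomRayleigh M
  · -- then `B ≥ ε₂ ≥ ?`; from `|ε₁| = ε₁ ≤ τ(ε₂ − ε₁)` we get `ε₁ ≤ τ ε₂ ≤ τ B`, and `ε₁ ≥ 0`
    rw [abs_of_nonneg h0] at hacc
    nlinarith
  · rw [abs_of_neg (not_le.1 h0)] at hacc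
    nlinarith

/-- **PROVED — ACCEPTANCE ⟹ NEAR-POSITIVITY (modulus ratio, dimension `≥ 2`).** If `|ε₁(M)| ≤ κ·|ε₂(M)|` with
`0 ≤ κ < 1`, and a plane has height `≤ B` with `B ≥ 0`, then `−κB ≤ ε₁(M)`. [folklore] -/
theorem neg_mul_le_bottomRayleigh_of_modulusRatio {n : ℕ} (hn : 0 < n) {M : Matrix (Fin (n + 1)) (Fin (n + 1)) ℝ}
    {x y : Fin (n + 1) → ℝ} (hx : x ≠ 0) (hy : y ≠ 0) (hxy : y ⬝ᵥ x = 0) {B : ℝ} (hB0 : 0 ≤ B)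
    (hB : ∀ α β : ℝ, (α • x + β • y) ⬝ᵥ (M *ᵥ (α • x + β • y)) ≤ B * ((α • x + β • y) ⬝ᵥ (α • x + β • y)))
    {κ : ℝ} (hκ0 : 0 ≤ κ) (hκ : κ < 1) (hacc : |bottomRayleigh M| ≤ κ * |secondRayleigh M|) :
    -(κ * B) ≤ bottomRayleigh M := by
  have h2 : secondRayleigh M ≤ B := secondRayleigh_le_of_plane hx hy hxy hB
  have h12 : bottomRayleigh M ≤ secondRayleigh M := bottomRayleigh_le_secondRayleigh hn M
  by_cases h0 : 0 ≤ bottomRayleigh M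
  · nlinarith [mul_nonneg hκ0 hB0]
  · rw [abs_of_neg (not_le.1 h0)] at hacc
    by_cases hs : 0 ≤ secondRayleigh M
    · rw [abs_of_nonneg hs] at hacc
      nlinarith [mul_le_mul_of_nonneg_left h2 hκ0]
    · rw [abs_of_neg (not_le.1 hs)] at hacc
      -- `−ε₁ ≤ κ(−ε₂) ≤ κ(−ε₁)` forces `ε₁ = 0`, contradicting `ε₁ < 0`
      nlinarith

/-! ## §2 Datum level at a window -/

/-- **PROVED — a member ACCEPTED by the gauge-ratio conjunct at `w` is at most `τB/(1 − τ)` negative there,**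
`B` = the height of any plane of the member at `w`. [folklore] -/
theorem bottomRayleigh_ge_of_mem_gaugeRatioAt {d : Datum} {τ : ℝ} {win : Window} (hmem : d ∈ gaugeRatioAt τ win)
    {x y : Fin (win.N + 1) → ℝ} (hx : x ≠ 0) (hy : y ≠ 0) (hxy : y ⬝ᵥ x = 0) {B : ℝ}
    (hB : ∀ α β : ℝ, (α • x + β • y) ⬝ᵥ (d win *ᵥ (α • x + β • y)) ≤ B * ((α • x + β • y) ⬝ᵥ (α • x + β • y)))
    (hτ0 : 0 ≤ τ) : -(τ * B) ≤ (1 - τ) * bottomRayleigh (d win) :=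
  neg_mul_le_bottomRayleigh_of_gaugeRatio hx hy hxy hB hτ0 hmem

/-- **PROVED — modulus version:** accepted by `modulusRatioAt κ w` + plane of height `≤ B`, `B ≥ 0`, dimension
`≥ 2` ⟹ `ε₁(d; w) ≥ −κB`. [folklore] -/
theorem bottomRayleigh_ge_of_mem_modulusRatioAt {d : Datum} {κ : ℝ} {win : Window} (hN : 0 < win.N)
    (hmem : d ∈ modulusRatioAt κ win) {x y : Fin (win.N + 1) → ℝ} (hx : x ≠ 0) (hy : y ≠ 0) (hxy : y ⬝ᵥ x = 0)
    {B : ℝ} (hB0 : 0 ≤ B)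
    (hB : ∀ α β : ℝ, (α • x + β • y) ⬝ᵥ (d win *ᵥ (α • x + β • y)) ≤ B * ((α • x + β • y) ⬝ᵥ (α • x + β • y)))
    (hκ0 : 0 ≤ κ) (hκ : κ < 1) : -(κ * B) ≤ bottomRayleigh (d win) :=
  neg_mul_le_bottomRayleigh_of_modulusRatio hN hx hy hxy hB0 hB hκ0 hκ hmem

/-! ## §3 The residue of the `(Z)`-cell, typed: `ζ`'s membership and its only failure mode -/

/-- **PROVED — WHAT `ζ ∈ gaugeRatioAt τ w` SAYS, given a plane of `ζ` of height `≤ η₂` at `w`:**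
`ε₁(ζ; w) ≥ −τη₂/(1 − τ)` (division-free: `−τη₂ ≤ (1 − τ)·ε₁(ζ; w)`) — `ζ` is at most `τ/(1 − τ)` times its
2-cluster height negative at `w`. Along far windows where `η₂(w) → 0` (B2; DATA PF-N2, not claimed) the
`∀`-window residue statement is therefore an ASYMPTOTIC POSITIVITY statement about `ζ` — RH-strength, untouched
here. [folklore] -/
theorem zeta_bottom_ge_of_mem_gaugeRatioAt {τ : ℝ} {win : Window} (hmem : zetaDatum ∈ gaugeRatioAt τ win)
    {x y : Fin (win.N + 1) → ℝ} (hx : x ≠ 0) (hy : y ≠ 0) (hxy : y ⬝ᵥ x = 0) {η₂ : ℝ}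
    (hZ : ∀ α β : ℝ, (α • x + β • y) ⬝ᵥ (zetaDatum win *ᵥ (α • x + β • y))
      ≤ η₂ * ((α • x + β • y) ⬝ᵥ (α • x + β • y)))
    (hτ0 : 0 ≤ τ) : -(τ * η₂) ≤ (1 - τ) * bottomRayleigh (zetaDatum win) :=
  bottomRayleigh_ge_of_mem_gaugeRatioAt hmem hx hy hxy hZ hτ0

/-- **PROVED — THE ONLY FAILURE MODE OF THE RESIDUE:** a window where `ζ` has a plane of height `≤ η₂` and a
vector MORE than `τη₂/(1 − τ)` negative (`vᵀζ_w v ≤ −m vᵀv`, `τη₂ < m(1 − τ)`) violates the conjunct: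
`ζ ∉ gaugeRatioAt τ w` (file 1's rejection law applied to `ζ`'s own matrix, push `0`). [folklore] -/
theorem zeta_not_mem_gaugeRatioAt_of_deep_negative {τ : ℝ} {win : Window} {x y : Fin (win.N + 1) → ℝ}
    (hx : x ≠ 0) (hy : y ≠ 0) (hxy : y ⬝ᵥ x = 0) {η₂ : ℝ}
    (hZ : ∀ α β : ℝ, (α • x + β • y) ⬝ᵥ (zetaDatum win *ᵥ (α • x + β • y))
      ≤ η₂ * ((α • x + β • y) ⬝ᵥ (α • x + β • y)))
    {v : Fin (win.N + 1) → ℝ} (hv : v ≠ 0) {m : ℝ} (hm : 0 < m)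
    (hneg : v ⬝ᵥ (zetaDatum win *ᵥ v) ≤ -m * (v ⬝ᵥ v)) (hτ0 : 0 ≤ τ) (hτ : τ < 1)
    (hdeep : τ * η₂ < m * (1 - τ)) : zetaDatum ∉ gaugeRatioAt τ win := by
  intro hmem
  simp only [gaugeRatioAt, mem_setOf_eq, bottomGapGauge] at hmem
  exact absurd hmem (not_le.2 (mul_gauge_lt_abs_bottom hv hm hneg hx hy hxy hZ hτ0 hτ hdeep))

/-- **PROVED — hence the `∀`-window residue fails at such a window:** `ζ ∉ GaugeRatioClass τ`. [folklore] -/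
theorem zeta_not_mem_gaugeRatioClass_of_deep_negative {τ : ℝ} {win : Window} {x y : Fin (win.N + 1) → ℝ}
    (hx : x ≠ 0) (hy : y ≠ 0) (hxy : y ⬝ᵥ x = 0) {η₂ : ℝ}
    (hZ : ∀ α β : ℝ, (α • x + β • y) ⬝ᵥ (zetaDatum win *ᵥ (α • x + β • y))
      ≤ η₂ * ((α • x + β • y) ⬝ᵥ (α • x + β • y)))
    {v : Fin (win.N + 1) → ℝ} (hv : v ≠ 0) {m : ℝ} (hm : 0 < m)
    (hneg : v ⬝ᵥ (zetaDatum win *ᵥ v) ≤ -m * (v ⬝ᵥ v)) (hτ0 : 0 ≤ τ) (hτ : τ < 1)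
    (hdeep : τ * η₂ < m * (1 - τ)) : zetaDatum ∉ GaugeRatioClass τ :=
  fun h => zeta_not_mem_gaugeRatioAt_of_deep_negative hx hy hxy hZ hv hm hneg hτ0 hτ hdeep (h win)

/-- **PROVED — and then NO class inside the `∀`-window conjunct separates `ζ` from anything** (it does not even
contain `ζ`). [folklore] -/
theorem not_separates_of_subset_gaugeRatioClass_of_deep_negative {S D : Set Datum} {τ : ℝ}
    (hS : S ⊆ GaugeRatioClass τ) {win : Window} {x y : Fin (win.N + 1) → ℝ} (hx : x ≠ 0) (hy : y ≠ 0)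
    (hxy : y ⬝ᵥ x = 0) {η₂ : ℝ}
    (hZ : ∀ α β : ℝ, (α • x + β • y) ⬝ᵥ (zetaDatum win *ᵥ (α • x + β • y))
      ≤ η₂ * ((α • x + β • y) ⬝ᵥ (α • x + β • y)))
    {v : Fin (win.N + 1) → ℝ} (hv : v ≠ 0) {m : ℝ} (hm : 0 < m)
    (hneg : v ⬝ᵥ (zetaDatum win *ᵥ v) ≤ -m * (v ⬝ᵥ v)) (hτ0 : 0 ≤ τ) (hτ : τ < 1)
    (hdeep : τ * η₂ < m * (1 - τ)) : ¬ Separates S D zetaDatum :=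
  fun hsep => zeta_not_mem_gaugeRatioClass_of_deep_negative hx hy hxy hZ hv hm hneg hτ0 hτ hdeep (hS hsep.1)

/-! ## §4 For the carver: the exact sense in which the sign-blind conjunct sees negativity -/

/-- **PROVED — SOUNDNESS READING.** If `S ⊆ gaugeRatioAt τ w` (`0 ≤ τ`; read with `τ < 1`) and `d ∈ S` has a plane of height
`≤ B` at `w`, then `d` is at most `τB/(1 − τ)` negative at `w`: the conjunct never accepts a member that is deeply
negative RELATIVE TO ITS OWN LOW PLANE. Members negative only far below their own cluster scale (the arrival cusp
of file 1) are the ones it can accept. [folklore] -/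
theorem separates_gaugeRatio_sound_reading {S : Set Datum} {τ : ℝ} {win : Window} (hS : S ⊆ gaugeRatioAt τ win)
    {d : Datum} (hd : d ∈ S) {x y : Fin (win.N + 1) → ℝ} (hx : x ≠ 0) (hy : y ≠ 0) (hxy : y ⬝ᵥ x = 0) {B : ℝ}
    (hB : ∀ α β : ℝ, (α • x + β • y) ⬝ᵥ (d win *ᵥ (α • x + β • y)) ≤ B * ((α • x + β • y) ⬝ᵥ (α • x + β • y)))
    (hτ0 : 0 ≤ τ) : -(τ * B) ≤ (1 - τ) * bottomRayleigh (d win) :=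
  bottomRayleigh_ge_of_mem_gaugeRatioAt (hS hd) hx hy hxy hB hτ0

end Summit.RiemannHypothesis.RiemannHypothesis.Theorems.PfPersistence

end
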